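import Literature.NumberTheory.EllipticCurves.FineSelmerClassGroupCriterionTorsionPointField
import HarnessLib

/-!
# Deo–Ray–Sujatha's hypothesis (c2) `Hom_G(H′_L, E[p]) = 0` when `p ∣ h(ℚ(P))`:
# the EIGENCLASS refinement — it suffices that `c` is not an eigenvalue of `τ₀` on `i_{L/K}(Cl_K)/p`
# for one `τ₀ ∈ Γ` with `τ₀P = cP`

Topic `NumberTheory/EllipticCurves`, sub-namespace `DeoRaySujatha2023`.  THEOREM-ONLY file (no definition,
no named fact, no `sorry`), unconditional except for the corollary taking the named fact
`thm39_fineSelmerDual_moduleFinite_of_homTrivial_divisionField` as a hypothesis.  Written by the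
literature seat `bsd-potss-conjA-anchor` g9 (cell `bsd-potss`, rungs K9/KT of `BirchSwinnertonDyer`;
`--supports` stmt-BirchSwinnertonDyer-19413; closes nothing; BSD is proved for no curve here).

## Why

`FineSelmerClassGroupCriterionTorsionPointField` (g8) discharges hypothesis (c2) of
[DeoRaySujatha2023] Thm. 3.8/3.9 — «every `Γ_ℚ`-equivariant additive map `Cl(𝓞_{ℚ(W[p])}) → W[p]`
vanishes» — from `p ∤ #Gal(ℚ(W[p])/ℚ)`, irreducibility and ONE class number `p ∤ h(K)` of a subfield
`K ⊆ ℚ(W[p])` fixing a non-zero `P` (the census field `K = ℚ(P)`).  On the cell's `(t′)` rows at `p = 5` that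
left the rows with `5 ∣ h(ℚ(P))` (census: 20 rows).  The planner's successor item «Lemma″» (memo
`FINDING-19413-p5-hesse-family-road-and-cha-door-conjA-anchor-g7.md` §2: «let `N = N_G(Stab P)`, …
`Hom_G(V, H_L) ↪ {a ∈ Cl(ℚ(P))/5 : φ₂·a = 2a}`; hence 2 not an eigenvalue of `φ₂` on `Cl(ℚ(P))/5 ⟹ (c2)`»;
6 rows pass numerically) is proved here in the following θ-free form.

## The statement (folklore refinement; proof below is this seat's, by a counting argument)

Setting of g8's `equivariantHom_classGroup_eq_zero_of_classNumber_subfield`: `L/F` finite Galois in `F̄`,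
`p ∤ #Gal(L/F)`, `V` a `p`-torsion `Γ_F`-module trivialised by `Γ_L` with no `Γ_F`-stable subgroups other
than `⊥`, `⊤`, `K ⊆ L`, `P ∈ V ∖ 0` fixed by `Γ_K`.  REPLACE «`p ∤ h_K`» BY: there are `τ₀ ∈ Γ_F` and
`c ∈ ℤ` with `τ₀P = cP` such that every extended class `i_{L/K}(d)`, `d ∈ Cl_K`, can be written
`τ₀·i_{L/K}(b) · i_{L/K}(b)^{−c} · i_{L/K}(e)^p` with `b, e ∈ Cl_K` («`τ₀ − c` is onto on `i_{L/K}(Cl_K)`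
modulo `p`-th powers» — for `K = ℚ(P)` and `τ₀` inducing `θ ∈ Aut(K/ℚ)` this is «`c` is not an eigenvalue
of `θ` on `Cl_K/p`», since `i_{L/K} ∘ θ = τ₀ ∘ i_{L/K}`; with `p ∤ h_K` take `b = 1`, `e = d^{1/p}`).
THEN every equivariant `f : Cl_L → V` vanishes.

Proof.  The image `M = f(Cl_L)` is `Γ_F`-stable (`τ·f(c) = f(τ c)`), so `M = 0` or `M = V`.  If `M = V`,
pick `a` with `f(a) = P`; summing over lifts of `H = Gal(L/K)` and using Neukirch III (1.6)(iv)
(`i(N c) = ∏_h h·c`, tree `classGroupExtend_classGroupNorm_eq_prod`) gives `#H·P = f(i(N a))`, and as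
`p ∤ #H`, `P = f(i(d₀))` for some `d₀ ∈ Cl_K`.  Let `S = f(i(Cl_K))`, a finite set containing `0` and `P`,
and `g(v) = τ₀v − cv`.  The hypothesis gives `S ⊆ g(S)` (`f(i d) = g(f(i b)) + p·f(i e) = g(f(i b))`), so
`#S ≤ #g(S) ≤ #S` and `g` is injective on `S`; but `g(P) = 0 = g(0)` with `P ≠ 0` — contradiction.

## Main results

* `equivariantHom_classGroup_eq_zero_of_eigenclass_subfield` — the abstract statement above.
* `homTrivial_divisionField_of_eigenclass_subfield` — `L = ℚ(W[p])`, `V = W[p]`: hypothesis (c2) of the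
  named fact VERBATIM from (c1), irreducibility and the eigenclass condition on a subfield.
* `thm39_of_homTrivial_of_eigenclass_stabilizerField` — Deo–Ray–Sujatha Thm. 3.9 (b) BY NAME with (c2)
  replaced by the eigenclass condition on `K = ℚ(P)` (the fixed field of `Stab P` inside `ℚ(W[p])`), for a
  `τ₀ ∈ Γ_ℚ` with `τ₀P = cP` — the shape of the cell's `drs5d.gp` certificates (matrix of `φ₂` on `Cl(ℚ(P))/5`).

## References

* S. V. Deo, A. Ray, R. Sujatha, *On the μ equals zero conjecture for fine Selmer groups in Iwasawa theory*,
  Pure Appl. Math. Q. 19 (2023), §3 Thm. 3.8 (c2), Thm. 3.9 (b) (arXiv:2202.09937 pp. 9–10). [DeoRaySujatha2023]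
* J. Neukirch, *Algebraic Number Theory* (1999), Ch. III §1 Prop. (1.6) (iv). [NeukirchANT1999]
-/

noncomputable section

open scoped Classical

namespace Literature.NumberTheory.EllipticCurves.DeoRaySujatha2023

open WeierstrassCurve IsDedekindDomain NumberField Field
open Literature.NumberTheory.GaloisRepresentations Literature.NumberTheory.NumberFields
open scoped nonZeroDivisors

/-- Restriction `Γ_F → Gal(L/F)` to a normal subextension of `F̄/F` is onto (Mathlib
`AlgEquiv.restrictNormalHom_surjective`). [folklore] -/
private theorem absRestrictNormalHom_surjective'' {F : Type*} [Field F]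
    (E : IntermediateField F (AlgebraicClosure F)) [Normal F E] :
    Function.Surjective (absRestrictNormalHom E) := fun g => by
  obtain ⟨σ, hσ⟩ := AlgEquiv.restrictNormalHom_surjective (AlgebraicClosure F) g
  exact ⟨(absoluteGaloisGroup.toAlgEquiv F).symm σ, hσ⟩

/-- A `p`-torsion element is fixed by `n •` whenever `n ≡ 1 (mod p)` in the form `n = 1 + p q`. [folklore] -/
private theorem nsmul_eq_self_of_mod {M : Type*} [AddCommMonoid M] {p n : ℕ} {x : M} (hx : p • x = 0)
    (hn : n % p = 1) : n • x = x := by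
  conv_lhs => rw [← Nat.mod_add_div n p, hn, add_nsmul, one_nsmul, mul_comm, mul_nsmul', hx, nsmul_zero, add_zero]

/-! ### The abstract statement -/

/-- **Equivariant homomorphisms `Cl(𝓞_L) → V` vanish under the eigenclass condition** (refinement of
`equivariantHom_classGroup_eq_zero_of_classNumber_subfield`: the hypothesis `p ∤ h_K` is replaced by
«`τ₀ − c` is onto on `i_{L/K}(Cl_K)` modulo `p`-th powers» for a `τ₀ ∈ Γ_F` with `τ₀P = cP`; statement and
proof in the module docstring; the triviality of the `Γ_L`-action on `V` is not even needed).  Equivariance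
phrased as in the named fact `thm39_fineSelmerDual_moduleFinite_of_homTrivial_divisionField` (with
`AmbiguousClass.intAut`).
[cite: DeoRaySujatha2023, §3 Thm. 3.8 (c2) (arXiv:2202.09937 p. 9)] [cite: NeukirchANT1999, Ch. III §1 Prop. (1.6) (iv)] -/
theorem equivariantHom_classGroup_eq_zero_of_eigenclass_subfield
    {F : Type} [Field F] (L : IntermediateField F (AlgebraicClosure F)) [FiniteDimensional F L]
    [IsGalois F L] [NumberField L] (p : ℕ) [Fact p.Prime]
    (hG : ¬ p ∣ Nat.card (L ≃ₐ[F] L))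
    {V : Type*} [AddCommGroup V] [DistribMulAction (absoluteGaloisGroup F) V]
    (hpV : ∀ v : V, p • v = 0)
    (hirr : ∀ U : AddSubgroup V,
      (∀ τ : absoluteGaloisGroup F, ∀ v ∈ U, τ • v ∈ U) → U = ⊥ ∨ U = ⊤)
    (K : IntermediateField F L) [NumberField K]
    (P : V) (hP0 : P ≠ 0)
    (hPK : ∀ τ : absoluteGaloisGroup F, (∀ x : K, absRestrictNormalHom L τ (x : L) = x) → τ • P = P)
    (τ₀ : absoluteGaloisGroup F) (c : ℤ) (hc : τ₀ • P = c • P)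
    (heig : ∀ d : ClassGroup (𝓞 K), ∃ b e : ClassGroup (𝓞 K),
      classGroupExtend K L d =
        ClassGroup.mulEquiv (AmbiguousClass.intAut (absRestrictNormalHom L τ₀)) (classGroupExtend K L b) *
          (classGroupExtend K L b) ^ (-c) * (classGroupExtend K L e) ^ p)
    (f : Additive (ClassGroup (𝓞 L)) →+ V)
    (hf : ∀ (τ : absoluteGaloisGroup F) (I J : (Ideal (𝓞 L))⁰),
      (J : Ideal (𝓞 L)) =
        (I : Ideal (𝓞 L)).map (AmbiguousClass.intAut (absRestrictNormalHom L τ) : 𝓞 L →+* 𝓞 L) →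
      f (Additive.ofMul (ClassGroup.mk0 J)) = τ • f (Additive.ofMul (ClassGroup.mk0 I))) :
    f = 0 := by
  have hp : p.Prime := Fact.out
  -- (0) `τ • f(c) = f(τ c)` on classes
  have hfgal : ∀ (τ : absoluteGaloisGroup F) (c : ClassGroup (𝓞 L)),
      f (Additive.ofMul (ClassGroup.mulEquiv (AmbiguousClass.intAut (absRestrictNormalHom L τ)) c)) =
        τ • f (Additive.ofMul c) := by
    intro τ c
    obtain ⟨I, rfl⟩ := ClassGroup.mk0_surjective c
    rw [AmbiguousClass.mulEquiv_mk0]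
    exact hf τ I ⟨_, AmbiguousClass.map_mem_nonZeroDivisors _ I⟩ rfl
  -- (1) the image of `f` is `Γ_F`-stable, hence `⊥` or `⊤`
  rcases hirr f.range (fun τ v hv => by
      obtain ⟨a, rfl⟩ := AddMonoidHom.mem_range.mp hv
      rw [← ofMul_toMul a, ← hfgal]
      exact ⟨_, rfl⟩) with hbot | htop
  · ext a
    have ha : f a ∈ (⊥ : AddSubgroup V) := hbot ▸ ⟨a, rfl⟩
    rwa [AddSubgroup.mem_bot] at ha
  exfalso
  -- (2) `H = Gal(L/K)` has order prime to `p`; lifts `τ_h ∈ Γ_F`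
  have hcardG : Nat.card (L ≃ₐ[F] L) = Module.finrank F L := IsGalois.card_aut_eq_finrank F L
  have hcardH : Fintype.card (L ≃ₐ[K] L) = Module.finrank K L := by
    rw [← Nat.card_eq_fintype_card]; exact IsGalois.card_aut_eq_finrank K L
  have hH : ¬ p ∣ Fintype.card (L ≃ₐ[K] L) := by
    intro hdvd
    apply hG
    rw [hcardG, ← Module.finrank_mul_finrank F K L, ← hcardH]
    exact dvd_mul_of_dvd_right hdvd _
  have hHcop : (Fintype.card (L ≃ₐ[K] L)).Coprime p :=
    Nat.coprime_comm.mp ((Nat.Prime.coprime_iff_not_dvd hp).mpr hH)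
  choose lift hlift using absRestrictNormalHom_surjective'' L
  set tl : (L ≃ₐ[K] L) → absoluteGaloisGroup F := fun h => lift (h.restrictScalars F) with htl
  have htl_res : ∀ h : L ≃ₐ[K] L, absRestrictNormalHom L (tl h) = h.restrictScalars F :=
    fun h => hlift _
  have htlP : ∀ h : L ≃ₐ[K] L, tl h • P = P := by
    intro h
    refine hPK _ fun x => ?_
    rw [htl_res]
    exact h.commutes x
  -- `f(h·c) = τ_h • f(c)` for `h ∈ H`
  have hf_gal : ∀ (h : L ≃ₐ[K] L) (c : ClassGroup (𝓞 L)),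
      f (Additive.ofMul (ClassGroup.mulEquiv (AmbiguousClass.intAut h) c)) =
        tl h • f (Additive.ofMul c) := by
    intro h c
    obtain ⟨I, rfl⟩ := ClassGroup.mk0_surjective c
    rw [AmbiguousClass.mulEquiv_mk0]
    have hJ : (((⟨_, AmbiguousClass.map_mem_nonZeroDivisors h I⟩ : (Ideal (𝓞 L))⁰) : (Ideal (𝓞 L))⁰) :
        Ideal (𝓞 L)) =
        (I : Ideal (𝓞 L)).map (AmbiguousClass.intAut (absRestrictNormalHom L (tl h)) : 𝓞 L →+* 𝓞 L) := by
      rw [htl_res]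
      rfl
    exact hf (tl h) I _ hJ
  -- (3) the norm relation: `Σ_h τ_h • f(c) = f(i(N c))`
  set φ : ClassGroup (𝓞 K) → V := fun d => f (Additive.ofMul (classGroupExtend K L d)) with hφdef
  have hφ : ∀ d, φ d = f (Additive.ofMul (classGroupExtend K L d)) := fun d => rfl
  have hφ_mul : ∀ d d' : ClassGroup (𝓞 K), φ (d * d') = φ d + φ d' := by
    intro d d'; rw [hφ, map_mul, ofMul_mul, map_add, hφ, hφ]
  have hφ_one : φ 1 = 0 := by rw [hφ, map_one, ofMul_one, map_zero]
  have hφ_pow : ∀ (d : ClassGroup (𝓞 K)) (n : ℕ), φ (d ^ n) = n • φ d := by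
    intro d n; rw [hφ, map_pow, ofMul_pow, map_nsmul, hφ]
  have hφ_zpow : ∀ (d : ClassGroup (𝓞 K)) (n : ℤ), φ (d ^ n) = n • φ d := by
    intro d n; rw [hφ, map_zpow, ofMul_zpow, map_zsmul, hφ]
  have hπf : ∀ c : ClassGroup (𝓞 L),
      ∑ h : L ≃ₐ[K] L, tl h • f (Additive.ofMul c) = φ (classGroupNorm K L c) := by
    intro c
    rw [hφ, classGroupExtend_classGroupNorm_eq_prod K L c, ofMul_prod, map_sum]
    exact Finset.sum_congr rfl fun h _ => (hf_gal h c).symm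
  -- (4) `P` is a value of `φ`
  obtain ⟨a, ha⟩ : ∃ a, f a = P := by
    have hP : P ∈ f.range := htop ▸ AddSubgroup.mem_top P
    exact AddMonoidHom.mem_range.mp hP
  have hsumP : Fintype.card (L ≃ₐ[K] L) • P = φ (classGroupNorm K L (Additive.toMul a)) := by
    rw [← hπf, ofMul_toMul, ha]
    simp_rw [htlP]
    rw [Finset.sum_const, Finset.card_univ]
  obtain ⟨m, -, hm⟩ := Nat.exists_mul_mod_eq_one_of_coprime hHcop hp.one_lt
  obtain ⟨d₀, hd₀⟩ : ∃ d₀, φ d₀ = P := by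
    refine ⟨classGroupNorm K L (Additive.toMul a) ^ m, ?_⟩
    rw [hφ_pow, ← hsumP, ← mul_nsmul, nsmul_eq_self_of_mod (hpV P) hm]
  -- (5) the finite set `S = φ(Cl_K)` satisfies `S ⊆ g(S)` for `g = τ₀ − c`
  set g : V → V := fun v => τ₀ • v - c • v with hgdef
  set S : Finset V := Finset.univ.image φ with hSdef
  have hSsub : S ⊆ S.image g := by
    intro v hv
    obtain ⟨d, -, rfl⟩ := Finset.mem_image.mp hv
    obtain ⟨b, e, hbe⟩ := heig d
    refine Finset.mem_image.mpr ⟨φ b, Finset.mem_image.mpr ⟨b, Finset.mem_univ _, rfl⟩, ?_⟩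
    rw [hφ d, hbe, ofMul_mul, ofMul_mul, map_add, map_add, hfgal, ← hφ, ofMul_zpow, map_zsmul, ← hφ,
      ofMul_pow, map_nsmul, ← hφ, hpV, add_zero, neg_smul, ← sub_eq_add_neg]
  have hcard : (S.image g).card = S.card :=
    le_antisymm Finset.card_image_le (Finset.card_le_card hSsub)
  have hinj : Set.InjOn g S := Finset.card_image_iff.mp hcard
  have hPS : P ∈ S := Finset.mem_image.mpr ⟨d₀, Finset.mem_univ _, hd₀⟩
  have h0S : (0 : V) ∈ S := Finset.mem_image.mpr ⟨1, Finset.mem_univ _, hφ_one⟩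
  have hgP : g P = g 0 := by
    simp only [hgdef, hc, sub_self, smul_zero]
  exact hP0 (hinj hPS h0S hgP)

/-! ### The `p`-division field of an elliptic curve over `ℚ` -/

/-- **Hypothesis (c2) of `thm39_fineSelmerDual_moduleFinite_of_homTrivial_divisionField`, verbatim,
under the eigenclass condition.**  For `W/ℚ` elliptic, `p` prime, `W[p]` irreducible,
`p ∤ #Gal(ℚ(W[p])/ℚ)`, a subfield `K ⊆ ℚ(W[p])` whose absolute Galois group fixes a non-zero `P ∈ W[p]`,
and `τ₀ ∈ Γ_ℚ`, `c ∈ ℤ` with `τ₀P = cP` such that `τ₀ − c` is onto on `i_{L/K}(Cl_K)` modulo `p`-th powers: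
every `Γ_ℚ`-equivariant additive `f : Cl(𝓞_{ℚ(W[p])}) → W[p]` vanishes (the unused prime-killing
hypothesis of the fact is kept for verbatim matching).  Specialisation of
`equivariantHom_classGroup_eq_zero_of_eigenclass_subfield` to `L = ℚ(W[p])`, `V = W[p]`.
[cite: DeoRaySujatha2023, §3 Thm. 3.8 (c2) (arXiv:2202.09937 p. 9)] [cite: NeukirchANT1999, Ch. III §1 Prop. (1.6) (iv)] -/
theorem homTrivial_divisionField_of_eigenclass_subfield
    (W : WeierstrassCurve ℚ) [W.IsElliptic] (p : ℕ) [Fact p.Prime] [NeZero p]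
    [NumberField (W.divisionField p)]
    (hirr : W.HasIrreducibleModPGaloisRep p)
    (hG : ¬ p ∣ Nat.card ((W.divisionField p) ≃ₐ[ℚ] (W.divisionField p)))
    (K : IntermediateField ℚ (W.divisionField p)) [NumberField K]
    (P : geomTorsion W (p : ℤ)) (hP0 : P ≠ 0)
    (hPK : ∀ τ : absoluteGaloisGroup ℚ,
      (∀ x : K, absRestrictNormalHom (W.divisionField p) τ (x : W.divisionField p) = x) → τ • P = P)
    (τ₀ : absoluteGaloisGroup ℚ) (c : ℤ) (hc : τ₀ • P = c • P)
    (heig : ∀ d : ClassGroup (𝓞 K), ∃ b e : ClassGroup (𝓞 K),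
      classGroupExtend K (W.divisionField p) d =
        ClassGroup.mulEquiv (AmbiguousClass.intAut (absRestrictNormalHom (W.divisionField p) τ₀))
            (classGroupExtend K (W.divisionField p) b) *
          (classGroupExtend K (W.divisionField p) b) ^ (-c) *
          (classGroupExtend K (W.divisionField p) e) ^ p)
    (f : Additive (ClassGroup (𝓞 (W.divisionField p))) →+ geomTorsion W (p : ℤ))
    (hf : ∀ (τ : absoluteGaloisGroup ℚ) (I J : (Ideal (𝓞 (W.divisionField p)))⁰),
      (J : Ideal (𝓞 (W.divisionField p))) =
        (I : Ideal (𝓞 (W.divisionField p))).map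
          (galRestrict ℤ ℚ (W.divisionField p) (𝓞 (W.divisionField p))
            (absRestrictNormalHom (W.divisionField p) τ)) →
      f (Additive.ofMul (ClassGroup.mk0 J)) = τ • f (Additive.ofMul (ClassGroup.mk0 I))) :
    f = 0 := by
  refine equivariantHom_classGroup_eq_zero_of_eigenclass_subfield (W.divisionField p) p hG
    ?_ hirr K P hP0 hPK τ₀ c hc heig f ?_
  · intro v
    exact AddSubgroup.torsionBy.nsmul v
  · -- the fact's `galRestrict ℤ ℚ` phrasing of `τ·I` is the `intAut` phrasing (same underlying map)
    intro τ I J hJ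
    refine hf τ I J ?_
    have key : ∀ x : 𝓞 (W.divisionField p),
        galRestrict ℤ ℚ (W.divisionField p) (𝓞 (W.divisionField p))
            (absRestrictNormalHom (W.divisionField p) τ) x =
          AmbiguousClass.intAut (absRestrictNormalHom (W.divisionField p) τ) x := by
      intro x
      refine RingOfIntegers.ext ?_
      exact algebraMap_galRestrict_apply ℤ _ x
    rw [hJ]
    simp only [Ideal.map]
    congr 1
    ext y
    simp only [Set.mem_image, SetLike.mem_coe, RingHom.coe_coe, key]

/-! ### Deo–Ray–Sujatha Thm. 3.9 (b) BY NAME, with (c2) from the eigenclass condition on `ℚ(P)` -/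

/-- **Deo–Ray–Sujatha 2023 Thm. 3.9 (b) BY NAME (hypothesis `h` = the named fact), with (c2) replaced by the
EIGENCLASS condition on `K = ℚ(P)`** — the fixed field, inside `ℚ(W[p])`, of (the image of) the stabiliser
of a non-zero `P ∈ W[p]` — for a `τ₀ ∈ Γ_ℚ` with `τ₀P = cP`: «`τ₀ − c` is onto on `i(Cl(ℚ(P)))` modulo
`p`-th powers» (for `c = 2`, `p = 5` this is the cell's certificate «`2` is not an eigenvalue of `φ₂` on
`Cl(ℚ(P))/5`», read through `i ∘ φ₂ = τ₀ ∘ i`).  Other hypotheses: `p` odd, `W[p]` irreducible, (c1)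
`p ∤ #Gal(ℚ(W[p])/ℚ)`, (c3).  Conclusion: statement (A) for `W` at `p` (`∃ γ D` form).  With `p ∤ h(ℚ(P))`
(`b = 1`) this is g8's `thm39_of_homTrivial_of_classNumber_stabilizerField`.  Conditional only on `h`.
[cite: DeoRaySujatha2023, §3 Thm. 3.8 (c2), Thm. 3.9 (b) (arXiv:2202.09937 pp. 9–10)]
[cite: NeukirchANT1999, Ch. III §1 Prop. (1.6) (iv)] -/
theorem thm39_of_homTrivial_of_eigenclass_stabilizerField
    (h : thm39_fineSelmerDual_moduleFinite_of_homTrivial_divisionField)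
    (W : WeierstrassCurve ℚ) [W.IsElliptic] (p : ℕ) [Fact p.Prime] (hp : p ≠ 2)
    (hirr : W.HasIrreducibleModPGaloisRep p)
    (hG : haveI : NeZero p := ⟨(Fact.out : p.Prime).ne_zero⟩
      ¬ p ∣ Nat.card ((W.divisionField p) ≃ₐ[ℚ] (W.divisionField p)))
    (P : geomTorsion W (p : ℤ)) (hP0 : P ≠ 0)
    (τ₀ : absoluteGaloisGroup ℚ) (c : ℤ) (hc : τ₀ • P = c • P)
    (heig : haveI : NeZero p := ⟨(Fact.out : p.Prime).ne_zero⟩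
      haveI : NumberField (W.divisionField p) := NumberField.mk
      letI K : IntermediateField ℚ (W.divisionField p) := IntermediateField.fixedField
        ((MulAction.stabilizer (absoluteGaloisGroup ℚ) P).map (absRestrictNormalHom (W.divisionField p)))
      ∀ d : ClassGroup (𝓞 K), ∃ b e : ClassGroup (𝓞 K),
        classGroupExtend K (W.divisionField p) d =
          ClassGroup.mulEquiv (AmbiguousClass.intAut (absRestrictNormalHom (W.divisionField p) τ₀))
              (classGroupExtend K (W.divisionField p) b) *
            (classGroupExtend K (W.divisionField p) b) ^ (-c) *
            (classGroupExtend K (W.divisionField p) e) ^ p)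
    (hloc : ∀ v : HeightOneSpectrum (𝓞 ℚ), (((p : ℕ) : 𝓞 ℚ) ∈ v.asIdeal ∨ ¬ W.HasGoodReductionAt v) →
      ∀ x : W.geomPrimaryTorsion p, p • x = 0 →
        (∀ d ∈ Literature.NumberTheory.EllipticCurves.GreenbergSelmer.decomp v, d • x = x) → x = 0)
    (κ : ZpExtension ℚ p) (hκ : κ.IsCyclotomic) :
    ∃ (γ : absoluteGaloisGroup ℚ) (D : W.FineSelmerDualData κ γ),
      Module.Finite ℤ_[p] (RestrictScalars ℤ_[p] (IwasawaAlgebra p) D.X) := by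
  haveI : NeZero p := ⟨(Fact.out : p.Prime).ne_zero⟩
  haveI : NumberField (W.divisionField p) := NumberField.mk
  set K : IntermediateField ℚ (W.divisionField p) := IntermediateField.fixedField
    ((MulAction.stabilizer (absoluteGaloisGroup ℚ) P).map (absRestrictNormalHom (W.divisionField p)))
    with hKdef
  haveI : NumberField K := NumberField.mk
  refine h W p hp hirr hG ?_ hloc κ hκ
  intro f hf _
  refine homTrivial_divisionField_of_eigenclass_subfield W p hirr hG K P hP0 ?_ τ₀ c hc heig f hf
  -- `τ|_L` fixing `K = Fix(Stab P)` pointwise lies in `Stab(P)|_L`, so `τ P = P`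
  intro τ hτ
  have hmem : absRestrictNormalHom (W.divisionField p) τ ∈
      (MulAction.stabilizer (absoluteGaloisGroup ℚ) P).map (absRestrictNormalHom (W.divisionField p)) := by
    rw [← IntermediateField.fixingSubgroup_fixedField
      ((MulAction.stabilizer (absoluteGaloisGroup ℚ) P).map (absRestrictNormalHom (W.divisionField p))),
      IntermediateField.mem_fixingSubgroup_iff]
    intro x hx
    exact hτ ⟨x, hx⟩
  obtain ⟨σ, hσ, hres⟩ := Subgroup.mem_map.mp hmem
  have h1 : absRestrictNormalHom (W.divisionField p) (σ⁻¹ * τ) = 1 := by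
    rw [map_mul, map_inv, hres, inv_mul_cancel]
  have h2 := (W.absRestrictNormalHom_divisionField_eq_one_iff p (σ⁻¹ * τ)).mp h1 P
  rw [mul_smul, inv_smul_eq_iff] at h2
  rw [h2]
  exact hσ

end Literature.NumberTheory.EllipticCurves.DeoRaySujatha2023


/-! ## APPEND (seat `bsd-potss-conjA-anchor` g9, 2026-08-28, same session): the commutation
`i_{L/K} ∘ θ = τ₀ ∘ i_{L/K}` on ideal classes and the θ-FORM of Lemma″ (the certificate's own currency:
an automorphism `θ` of `K = ℚ(P)` and its action on `Cl_K`) -/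

namespace Literature.NumberTheory.EllipticCurves.DeoRaySujatha2023

open WeierstrassCurve IsDedekindDomain NumberField Field
open Literature.NumberTheory.GaloisRepresentations Literature.NumberTheory.NumberFields
open scoped nonZeroDivisors

/-- **`i_{L/K}(θ·d) = σ·i_{L/K}(d)`** for ideal classes `d ∈ Cl_K`, whenever the automorphism `σ` of `L`
restricts to the automorphism `θ` of `K` (`σ(x) = θ(x)` for `x ∈ K`): extension of ideals commutes with
compatible automorphisms (`(θ𝔞)𝓞_L = σ(𝔞𝓞_L)`).
[cite: NeukirchANT1999, Ch. III §1 Prop. (1.6) (functoriality of i_{L|K})] -/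
theorem classGroupExtend_mulEquiv_intAut_of_restrict {F : Type*} [Field F] (K L : Type) [Field K]
    [NumberField K] [Field L] [NumberField L] [Algebra F K] [Algebra F L] [Algebra K L]
    (θ : K ≃ₐ[F] K) (σ : L ≃ₐ[F] L) (hθ : ∀ x : K, algebraMap K L (θ x) = σ (algebraMap K L x))
    (d : ClassGroup (𝓞 K)) :
    classGroupExtend K L (ClassGroup.mulEquiv (AmbiguousClass.intAut θ) d) =
      ClassGroup.mulEquiv (AmbiguousClass.intAut σ) (classGroupExtend K L d) := by
  obtain ⟨I, rfl⟩ := ClassGroup.mk0_surjective d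
  rw [AmbiguousClass.mulEquiv_mk0, classGroupExtend_mk0, classGroupExtend_mk0,
    AmbiguousClass.mulEquiv_mk0]
  congr 1
  apply Subtype.ext
  change ((I : Ideal (𝓞 K)).map _).map _ = ((I : Ideal (𝓞 K)).map _).map _
  rw [Ideal.map_map, Ideal.map_map]
  congr 1
  refine RingHom.ext fun x => RingOfIntegers.ext ?_
  change ((algebraMap (𝓞 K) (𝓞 L) (AmbiguousClass.intAut θ x) : 𝓞 L) : L) =
    ((AmbiguousClass.intAut σ (algebraMap (𝓞 K) (𝓞 L) x) : 𝓞 L) : L)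
  exact hθ x

/-- **The θ-form of the eigenclass condition implies the `i_{L/K}`-form.**  If `σ ∈ Aut(L/F)` restricts to
`θ ∈ Aut(K/F)` and every `d ∈ Cl_K` can be written `θ·b · b^{−c} · e^p` (i.e. `θ − c` is onto on `Cl_K`
modulo `p`-th powers, e.g. «`c` is not an eigenvalue of `θ` on `Cl_K/p`»), then every `i_{L/K}(d)` can
be written `σ·i(b) · i(b)^{−c} · i(e)^p`. [cite: NeukirchANT1999, Ch. III §1 Prop. (1.6)] -/
theorem eigenclass_extend_of_eigenclass {F : Type*} [Field F] (K L : Type) [Field K]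
    [NumberField K] [Field L] [NumberField L] [Algebra F K] [Algebra F L] [Algebra K L]
    (θ : K ≃ₐ[F] K) (σ : L ≃ₐ[F] L) (hθ : ∀ x : K, algebraMap K L (θ x) = σ (algebraMap K L x))
    (c : ℤ) (p : ℕ)
    (heigK : ∀ d : ClassGroup (𝓞 K), ∃ b e : ClassGroup (𝓞 K),
      d = ClassGroup.mulEquiv (AmbiguousClass.intAut θ) b * b ^ (-c) * e ^ p)
    (d : ClassGroup (𝓞 K)) :
    ∃ b e : ClassGroup (𝓞 K),
      classGroupExtend K L d =
        ClassGroup.mulEquiv (AmbiguousClass.intAut σ) (classGroupExtend K L b) *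
          (classGroupExtend K L b) ^ (-c) * (classGroupExtend K L e) ^ p := by
  obtain ⟨b, e, hbe⟩ := heigK d
  refine ⟨b, e, ?_⟩
  rw [hbe, map_mul, map_mul, map_zpow, map_pow, classGroupExtend_mulEquiv_intAut_of_restrict K L θ σ hθ]

/-- **The restriction of `τ₀` to `ℚ(P)` is an automorphism of `ℚ(P)`** whenever `τ₀P = cP`: for
`K = Fix(Stab P)` inside `L = ℚ(W[p])`, `τ₀|_L` maps `K` into itself (`σ ∈ Stab P ⇒ τ₀⁻¹στ₀ ∈ Stab P`,
because `σ` fixes `cP = τ₀P`), so it restricts to some `θ ∈ Aut(K/ℚ)` — the automorphism `φ_c` of the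
cell's certificates («`φ₂(P) = 2P`» at `p = 5`).
[cite: DeoRaySujatha2023, §3 (the field ℚ(E[p]) and the hypothesis (c2))] -/
theorem exists_algEquiv_stabilizerField_restrict
    (W : WeierstrassCurve ℚ) [W.IsElliptic] (p : ℕ) [Fact p.Prime] [NeZero p]
    (P : geomTorsion W (p : ℤ)) (τ₀ : absoluteGaloisGroup ℚ) (c : ℤ) (hc : τ₀ • P = c • P) :
    ∃ θ : (IntermediateField.fixedField ((MulAction.stabilizer (absoluteGaloisGroup ℚ) P).map
          (absRestrictNormalHom (W.divisionField p)))) ≃ₐ[ℚ]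
        (IntermediateField.fixedField ((MulAction.stabilizer (absoluteGaloisGroup ℚ) P).map
          (absRestrictNormalHom (W.divisionField p)))),
      ∀ x, ((θ x : IntermediateField.fixedField ((MulAction.stabilizer (absoluteGaloisGroup ℚ) P).map
          (absRestrictNormalHom (W.divisionField p)))) : W.divisionField p) =
        absRestrictNormalHom (W.divisionField p) τ₀ x := by
  set L := W.divisionField p with hLdef
  set S := (MulAction.stabilizer (absoluteGaloisGroup ℚ) P).map (absRestrictNormalHom L) with hSdef
  set K : IntermediateField ℚ L := IntermediateField.fixedField S with hKdef
  -- `τ₀|_L` maps `K` into `K`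
  have hmem : ∀ x : K, absRestrictNormalHom L τ₀ (x : L) ∈ K := by
    intro x
    change absRestrictNormalHom L τ₀ (x : L) ∈ IntermediateField.fixedField S
    rw [IntermediateField.mem_fixedField_iff]
    rintro g ⟨σ, hσ, rfl⟩
    have hσ' : τ₀⁻¹ * σ * τ₀ ∈ MulAction.stabilizer (absoluteGaloisGroup ℚ) P := by
      rw [MulAction.mem_stabilizer_iff, mul_smul, mul_smul, hc,
        show σ • (c • P) = c • (σ • P) from map_zsmul (DistribSMul.toAddMonoidHom _ σ) c P,
        MulAction.mem_stabilizer_iff.mp hσ, ← hc, inv_smul_smul]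
    have hfix := (IntermediateField.mem_fixedField_iff S (x : L)).mp x.2 _ ⟨_, hσ', rfl⟩
    rw [map_mul, map_mul, AlgEquiv.mul_apply, AlgEquiv.mul_apply, map_inv, AlgEquiv.aut_inv,
      AlgEquiv.symm_apply_eq] at hfix
    -- hfix : σ|_L (τ₀|_L x) = τ₀|_L x  (after unfolding)
    change absRestrictNormalHom L σ (absRestrictNormalHom L τ₀ (x : L)) = absRestrictNormalHom L τ₀ x
    exact hfix
  let φ : K →ₐ[ℚ] K :=
    { toFun := fun x => ⟨absRestrictNormalHom L τ₀ (x : L), hmem x⟩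
      map_one' := Subtype.ext (by simp only [OneMemClass.coe_one, map_one])
      map_mul' := fun x y => Subtype.ext (by simp only [MulMemClass.coe_mul, map_mul])
      map_zero' := Subtype.ext (by simp only [ZeroMemClass.coe_zero, map_zero])
      map_add' := fun x y => Subtype.ext (by simp only [AddMemClass.coe_add, map_add])
      commutes' := fun r => Subtype.ext ((absRestrictNormalHom L τ₀).commutes r) }
  have hφ : ∀ x : K, ((φ x : K) : L) = absRestrictNormalHom L τ₀ x := fun x => rfl
  haveI : Algebra.IsAlgebraic ℚ K := Algebra.IsAlgebraic.of_finite ℚ K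
  refine ⟨AlgEquiv.ofBijective φ (Algebra.IsAlgebraic.algHom_bijective φ), fun x => ?_⟩
  rw [AlgEquiv.ofBijective_apply]
  exact hφ x

/-- **Deo–Ray–Sujatha 2023 Thm. 3.9 (b) BY NAME with (c2) from the eigenclass certificate IN `Cl(ℚ(P))`**
(the θ-form; `K = ℚ(P) := Fix(Stab P)` inside `ℚ(W[p])`): hypotheses `h` (the named fact), `p` odd,
`W[p]` irreducible, (c1), `τ₀ ∈ Γ_ℚ` and `c` with `τ₀P = cP`, an automorphism `θ` of `K` that IS the
restriction of `τ₀` (`exists_algEquiv_stabilizerField_restrict`), the certificate «every class of `K` is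
`θ·b · b^{−c} · e^p`» (⟸ `c` not an eigenvalue of `θ` on `Cl_K/p`), and (c3).  Conclusion: statement (A)
for `W` at `p`.  Conditional only on `h`.
[cite: DeoRaySujatha2023, §3 Thm. 3.8 (c2), Thm. 3.9 (b) (arXiv:2202.09937 pp. 9–10)]
[cite: NeukirchANT1999, Ch. III §1 Prop. (1.6) (iv)] -/
theorem thm39_of_homTrivial_of_eigenclassK_stabilizerField
    (h : thm39_fineSelmerDual_moduleFinite_of_homTrivial_divisionField)
    (W : WeierstrassCurve ℚ) [W.IsElliptic] (p : ℕ) [Fact p.Prime] (hp : p ≠ 2)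
    (hirr : W.HasIrreducibleModPGaloisRep p)
    (hG : haveI : NeZero p := ⟨(Fact.out : p.Prime).ne_zero⟩
      ¬ p ∣ Nat.card ((W.divisionField p) ≃ₐ[ℚ] (W.divisionField p)))
    (P : geomTorsion W (p : ℤ)) (hP0 : P ≠ 0)
    (τ₀ : absoluteGaloisGroup ℚ) (c : ℤ) (hc : τ₀ • P = c • P)
    (θ : haveI : NeZero p := ⟨(Fact.out : p.Prime).ne_zero⟩
      (IntermediateField.fixedField ((MulAction.stabilizer (absoluteGaloisGroup ℚ) P).map
          (absRestrictNormalHom (W.divisionField p)))) ≃ₐ[ℚ]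
        (IntermediateField.fixedField ((MulAction.stabilizer (absoluteGaloisGroup ℚ) P).map
          (absRestrictNormalHom (W.divisionField p)))))
    (hθ : haveI : NeZero p := ⟨(Fact.out : p.Prime).ne_zero⟩
      ∀ x, ((θ x : IntermediateField.fixedField ((MulAction.stabilizer (absoluteGaloisGroup ℚ) P).map
          (absRestrictNormalHom (W.divisionField p)))) : W.divisionField p) =
        absRestrictNormalHom (W.divisionField p) τ₀ x)
    (heigK : haveI : NeZero p := ⟨(Fact.out : p.Prime).ne_zero⟩
      haveI : NumberField (W.divisionField p) := NumberField.mk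
      ∀ d : ClassGroup (𝓞 (IntermediateField.fixedField ((MulAction.stabilizer (absoluteGaloisGroup ℚ) P).map
          (absRestrictNormalHom (W.divisionField p))))),
        ∃ b e, d = ClassGroup.mulEquiv (AmbiguousClass.intAut θ) b * b ^ (-c) * e ^ p)
    (hloc : ∀ v : HeightOneSpectrum (𝓞 ℚ), (((p : ℕ) : 𝓞 ℚ) ∈ v.asIdeal ∨ ¬ W.HasGoodReductionAt v) →
      ∀ x : W.geomPrimaryTorsion p, p • x = 0 →
        (∀ d ∈ Literature.NumberTheory.EllipticCurves.GreenbergSelmer.decomp v, d • x = x) → x = 0)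
    (κ : ZpExtension ℚ p) (hκ : κ.IsCyclotomic) :
    ∃ (γ : absoluteGaloisGroup ℚ) (D : W.FineSelmerDualData κ γ),
      Module.Finite ℤ_[p] (RestrictScalars ℤ_[p] (IwasawaAlgebra p) D.X) := by
  haveI : NeZero p := ⟨(Fact.out : p.Prime).ne_zero⟩
  haveI : NumberField (W.divisionField p) := NumberField.mk
  set K : IntermediateField ℚ (W.divisionField p) := IntermediateField.fixedField
    ((MulAction.stabilizer (absoluteGaloisGroup ℚ) P).map (absRestrictNormalHom (W.divisionField p)))
    with hKdef
  haveI : NumberField K := NumberField.mk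
  refine thm39_of_homTrivial_of_eigenclass_stabilizerField h W p hp hirr hG P hP0 τ₀ c hc ?_ hloc κ hκ
  exact @eigenclass_extend_of_eigenclass ℚ _ K (W.divisionField p) _ inferInstance _ _ _ _ _ θ
    (absRestrictNormalHom (W.divisionField p) τ₀) (fun x => hθ x) c p heigK

end Literature.NumberTheory.EllipticCurves.DeoRaySujatha2023

end
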